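import Literature.NumberTheory.BeurlingPrimes.HilberdinkCounting
import Literature.NumberTheory.BeurlingPrimes.EulerProduct
import Literature.NumberTheory.LFunctions.RieszMeanPerron
import HarnessLib

/-!
# Perron's formula of order one for Beurling integer-counting functions

Topic `Literature/NumberTheory/BeurlingPrimes`. Everything in this file is PROVED.

For a Beurling generalized prime system `𝒫` with integer-counting function `N_𝒫` and zeta function
`ζ_𝒫(s) = Σ_{n ∈ 𝒩} n^{−s}` (tree: `BeurlingPrimes.intCount`, `BeurlingPrimes.zeta`), the Riesz mean of order one
of the integers,

  `N₁(y) := Σ_{n ∈ 𝒩} (y − n)⁺ = ∫₀^y N_𝒫(u) du`   (`BeurlingPrimes.rieszCount`),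

is given for `y > 0` and `σ > 1` (with `Σ_j λ_j^{−σ} < ∞`) by the absolutely convergent Perron integral

  `N₁(y) = (1/2πi) ∫_{σ−i∞}^{σ+i∞} y^{s+1} ζ_𝒫(s) ds/(s(s+1)) = (1/2π) ∫_{−∞}^{∞} y^{1+s} ζ_𝒫(s)/(s(s+1)) dt`,
  `s = σ + it` (`rieszCount_eq_integral`),

and, since `N_𝒫` is non-decreasing, `N₁(x) − N₁(x−1) ≤ N_𝒫(x) ≤ N₁(x+1) − N₁(x)`
(`rieszCount_sub_le_intCount`, `intCount_le_rieszCount_sub`), so that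

  `N_𝒫(x) ≤ (1/2π) ∫ ((x+1)^{s+1} − x^{s+1}) ζ_𝒫(s)/(s(s+1)) dt`, and `≥` the same with `(x, x−1)`
  (`rieszCount_sub_eq_integral`).

This is the starting point of the Perron inversion "in the spirit of Diamond–Zhang" used by Broucke–Vindas
(2024, proof of Theorem 3.1: "we will apply the Perron formula to `N₁(x) := ∫₁ˣ N(u) du`, because then the
Perron integral is absolutely convergent … `N₁(x) − N₁(x−1) ≤ N(x) ≤ N₁(x+1) − N₁(x)`") and by
Broucke–Debruyne–Révész (2023, (3.5)–(3.6) and §4). The kernel identity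
`(1/2πi)∫_{(σ)} y^{s} ds/(s(s+1)) = (1 − 1/y)⁺` is the tree's
`Literature.NumberTheory.LFunctions.mellinInv_kernel_eq` (file `LFunctions/RieszMeanPerron.lean`, where the same
formula is proved for the Riesz mean of the von Mangoldt function); here the absolutely convergent interchange
of `Σ_{n ∈ 𝒩}` and `∫ dt` uses `BeurlingPrimes.summable_norm_genInt_cpow` (`EulerProduct.lean`).

## References
* [BrouckeVindas2024] F. Broucke, J. Vindas, *A new generalized prime random approximation procedure and some of
  its applications*, Math. Z. 307 (2024), arXiv:2102.08478, proof of Theorem 3.1 (read).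
* [BrouckeDebruyneRevesz2023] F. Broucke, G. Debruyne, Sz. Gy. Révész, *Some examples of well-behaved Beurling
  number systems*, arXiv:2309.01567, proof of Theorem 3.2, (3.5)–(3.6) (read).
* [MontgomeryVaughan2007] H. L. Montgomery, R. C. Vaughan, *Multiplicative Number Theory I*, CUP 2007, §5.1
  (Riesz means, (5.19)–(5.20)).
-/

noncomputable section

open Complex Filter Set MeasureTheory Real
open scoped Topology

namespace Literature.NumberTheory.BeurlingPrimes

open Literature.Barriers.RiemannHypothesis Literature.NumberTheory.LFunctions

variable (P : BeurlingPrimes)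

/-! ### The Riesz mean `N₁(y) = Σ_n (y − n)⁺` of the generalized integers -/

/-- The **Riesz mean of order one** of the generalized integers, `N₁(y) = Σ_{n ∈ 𝒩} (y − n)⁺ = ∫₀^y N_𝒫(u) du`
(BV 2024, proof of Thm. 3.1: "`N₁(x) := ∫₁ˣ N(u) du`"), as the `tsum` over exponent vectors of the finitely
supported family `k ↦ (y − n_k)⁺` (dot-notation extension of the barrier file's `BeurlingPrimes`, declared with
its absolute name). [cite: BrouckeVindas2024, proof of Theorem 3.1] -/
def _root_.Literature.Barriers.RiemannHypothesis.BeurlingPrimes.rieszCount (y : ℝ) : ℝ :=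
  ∑' k : ℕ →₀ ℕ, max (y - P.genInt k) 0

/-- `N₁(y) = Σ_{n_k ≤ y} (y − n_k)`, a finite sum over `Hilberdink.intFinset P y`. [folklore] -/
theorem _root_.Literature.Barriers.RiemannHypothesis.BeurlingPrimes.rieszCount_eq_sum (y : ℝ) :
    P.rieszCount y = ∑ k ∈ Hilberdink.intFinset P y, (y - P.genInt k) := by
  unfold BeurlingPrimes.rieszCount
  rw [tsum_eq_sum (s := Hilberdink.intFinset P y)]
  · refine Finset.sum_congr rfl fun k hk ↦ ?_
    rw [Hilberdink.mem_intFinset] at hk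
    exact max_eq_left (by linarith)
  · intro k hk
    rw [Hilberdink.mem_intFinset, not_le] at hk
    exact max_eq_right (by linarith)

/-- `N₁(y) ≥ 0`. [folklore] -/
theorem _root_.Literature.Barriers.RiemannHypothesis.BeurlingPrimes.rieszCount_nonneg (y : ℝ) :
    0 ≤ P.rieszCount y :=
  tsum_nonneg fun _ ↦ le_max_right _ _

/-- `N₁(y) = 0` for `y ≤ 1` (every generalized integer is `≥ 1`). [folklore] -/
theorem _root_.Literature.Barriers.RiemannHypothesis.BeurlingPrimes.rieszCount_eq_zero_of_le_one {y : ℝ}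
    (hy : y ≤ 1) : P.rieszCount y = 0 := by
  unfold BeurlingPrimes.rieszCount
  have h : ∀ k : ℕ →₀ ℕ, max (y - P.genInt k) 0 = 0 := fun k ↦
    max_eq_right (by linarith [P.one_le_genInt k])
  simp [h]

/-- **`N_𝒫(x) ≤ N₁(x+1) − N₁(x)`**: each `n_k ≤ x` contributes `(x+1−n_k) − (x−n_k) = 1`, the other terms
are `≥ 0` (BV 2024: "`N(x) ≤ N₁(x+1) − N₁(x)`"). [cite: BrouckeVindas2024, proof of Theorem 3.1] -/
theorem _root_.Literature.Barriers.RiemannHypothesis.BeurlingPrimes.intCount_le_rieszCount_sub (x : ℝ) :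
    (P.intCount x : ℝ) ≤ P.rieszCount (x + 1) - P.rieszCount x := by
  classical
  rw [P.rieszCount_eq_sum (x + 1), P.rieszCount_eq_sum x, Hilberdink.intCount_eq_card P x]
  have hsub : Hilberdink.intFinset P x ⊆ Hilberdink.intFinset P (x + 1) :=
    Hilberdink.intFinset_mono P (by linarith)
  rw [← Finset.sum_sdiff hsub, add_sub_assoc, ← Finset.sum_sub_distrib]
  have h1 : ∑ k ∈ Hilberdink.intFinset P x, (x + 1 - P.genInt k - (x - P.genInt k)) =
      ((Hilberdink.intFinset P x).card : ℝ) := by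
    rw [Finset.sum_congr rfl (g := fun _ ↦ (1 : ℝ)) (fun k _ ↦ by ring), Finset.sum_const, nsmul_eq_mul,
      mul_one]
  rw [h1]
  have h2 : 0 ≤ ∑ k ∈ Hilberdink.intFinset P (x + 1) \ Hilberdink.intFinset P x, (x + 1 - P.genInt k) :=
    Finset.sum_nonneg fun k hk ↦ by
      rw [Finset.mem_sdiff, Hilberdink.mem_intFinset] at hk
      linarith [hk.1]
  linarith

/-- **`N₁(x) − N₁(x−1) ≤ N_𝒫(x)`**: each `n_k ≤ x` contributes `(x−n_k) − (x−1−n_k)⁺ ≤ 1` and the terms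
with `n_k > x` vanish (BV 2024: "`N₁(x) − N₁(x−1) ≤ N(x)`"). [cite: BrouckeVindas2024, proof of Theorem 3.1] -/
theorem _root_.Literature.Barriers.RiemannHypothesis.BeurlingPrimes.rieszCount_sub_le_intCount (x : ℝ) :
    P.rieszCount x - P.rieszCount (x - 1) ≤ (P.intCount x : ℝ) := by
  classical
  rw [P.rieszCount_eq_sum x, Hilberdink.intCount_eq_card P x]
  -- write `N₁(x−1)` as a sum over the larger finset `intFinset P x`
  have hN1 : P.rieszCount (x - 1) = ∑ k ∈ Hilberdink.intFinset P x, max (x - 1 - P.genInt k) 0 := by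
    unfold BeurlingPrimes.rieszCount
    rw [tsum_eq_sum (s := Hilberdink.intFinset P x)]
    intro k hk
    rw [Hilberdink.mem_intFinset, not_le] at hk
    exact max_eq_right (by linarith)
  rw [hN1, ← Finset.sum_sub_distrib]
  have h : ∀ k ∈ Hilberdink.intFinset P x, x - P.genInt k - max (x - 1 - P.genInt k) 0 ≤ 1 := by
    intro k _
    have := le_max_left (x - 1 - P.genInt k) 0
    linarith
  calc ∑ k ∈ Hilberdink.intFinset P x, (x - P.genInt k - max (x - 1 - P.genInt k) 0)
      ≤ ∑ k ∈ Hilberdink.intFinset P x, (1 : ℝ) := Finset.sum_le_sum h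
    _ = ((Hilberdink.intFinset P x).card : ℝ) := by simp

/-! ### One term: the Perron kernel of order one -/

/-- **One term of the Perron integral.** For `y, n > 0` and `σ > 0`, with `s = σ + it`:
`(y − n)⁺ = (1/2π) ∫_{−∞}^{∞} y^{1+s} n^{−s} dt/(s(s+1))` — the kernel identity
`(1/2πi)∫_{(σ)} v^{−s} ds/(s(s+1)) = (1 − v)⁺` (`mellinInv_kernel_eq`) at `v = n/y`, times `y`. [folklore] -/
theorem posPart_sub_eq_integral {y n : ℝ} (hy : 0 < y) (hn : 0 < n) {σ : ℝ} (hσ : 0 < σ) :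
    ((max (y - n) 0 : ℝ) : ℂ) =
      (1 / (2 * π) : ℂ) * ∫ t : ℝ, (y : ℂ) ^ (1 + ((σ : ℂ) + t * I)) * (n : ℂ) ^ (-((σ : ℂ) + t * I)) *
        (1 / (((σ : ℂ) + t * I) * ((σ : ℂ) + t * I + 1))) := by
  have hy' : 0 < n / y := div_pos hn hy
  have hK := mellinInv_kernel_eq hσ hy'
  unfold mellinInv at hK
  -- `y · (1 − n/y)⁺ = (y − n)⁺`
  have hmax : y * max (1 - n / y) 0 = max (y - n) 0 := by
    rw [mul_max_of_nonneg _ _ hy.le, mul_sub, mul_one, mul_div_cancel₀ _ hy.ne', mul_zero]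
  have hlhs : ((max (y - n) 0 : ℝ) : ℂ) = (y : ℂ) * ((max (1 - n / y) 0 : ℝ) : ℂ) := by
    rw [← hmax]; push_cast; ring
  rw [hlhs, ← hK, Complex.real_smul]
  have hy0 : (y : ℂ) ≠ 0 := ofReal_ne_zero.2 hy.ne'
  have hnC : (n : ℂ) ≠ 0 := ofReal_ne_zero.2 hn.ne'
  -- pointwise identity of the integrands
  have hpt : ∀ t : ℝ, (y : ℂ) *
      (((n : ℂ) / (y : ℂ)) ^ (-((σ : ℂ) + t * I)) • (1 / (((σ : ℂ) + t * I) * ((σ : ℂ) + t * I + 1)))) =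
      (y : ℂ) ^ (1 + ((σ : ℂ) + t * I)) * (n : ℂ) ^ (-((σ : ℂ) + t * I)) *
        (1 / (((σ : ℂ) + t * I) * ((σ : ℂ) + t * I + 1))) := by
    intro t
    set s : ℂ := (σ : ℂ) + t * I with hs
    simp only [smul_eq_mul]
    -- `(n/y)^{-s} = y^s / n^s`
    have hpow : ((n : ℂ) / (y : ℂ)) ^ (-s) = (y : ℂ) ^ s / (n : ℂ) ^ s := by
      rw [show (n : ℂ) / (y : ℂ) = (((n * y⁻¹ : ℝ)) : ℂ) by push_cast; ring, cpow_neg,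
        ofReal_mul, mul_cpow_ofReal_nonneg hn.le (inv_nonneg.2 hy.le), ofReal_inv,
        inv_cpow _ _ ?_, mul_inv, inv_inv]
      · ring
      · rw [arg_ofReal_of_nonneg hy.le]; exact Real.pi_pos.ne
    have hns : (n : ℂ) ^ s ≠ 0 := cpow_ne_zero_iff.2 (Or.inl hnC)
    rw [hpow, cpow_neg]
    conv_rhs => rw [cpow_add _ _ hy0, cpow_one]
    field_simp
  calc (y : ℂ) * ((((1 / (2 * π) : ℝ)) : ℂ) *
        ∫ t : ℝ, (((n / y : ℝ)) : ℂ) ^ (-((σ : ℂ) + t * I)) •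
          (fun s : ℂ ↦ 1 / (s * (s + 1))) ((σ : ℂ) + t * I))
      = (((1 / (2 * π) : ℝ)) : ℂ) * ∫ t : ℝ, (y : ℂ) *
          ((((n / y : ℝ)) : ℂ) ^ (-((σ : ℂ) + t * I)) •
            (fun s : ℂ ↦ 1 / (s * (s + 1))) ((σ : ℂ) + t * I)) := by
        rw [integral_const_mul]; ring
    _ = _ := by
        push_cast
        congr 1
        exact integral_congr_ae (Eventually.of_forall hpt)

/-! ### The Perron integral for `N₁` -/

/-- `‖ζ_𝒫(σ + it)‖ ≤ Σ_k n_k^{−σ} (= ζ_𝒫(σ))` for `σ > 0` with `Σ_j λ_j^{−σ} < ∞`. [folklore] -/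
theorem _root_.Literature.Barriers.RiemannHypothesis.BeurlingPrimes.norm_zeta_le_tsum {σ : ℝ} (hσ : 0 < σ)
    (hsum : Summable fun j ↦ P.prime j ^ (-σ)) (t : ℝ) :
    ‖P.zeta ((σ : ℂ) + t * I)‖ ≤ ∑' k : ℕ →₀ ℕ, ‖((P.genInt k : ℝ) : ℂ) ^ (-(σ : ℂ))‖ := by
  have hS : Summable fun k : ℕ →₀ ℕ ↦ ‖((P.genInt k : ℝ) : ℂ) ^ (-(σ : ℂ))‖ :=
    P.summable_norm_genInt_cpow (s := (σ : ℂ)) (by simpa using hσ) (by simpa using hsum)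
  have h1 : Summable fun k : ℕ →₀ ℕ ↦ ‖((P.genInt k : ℝ) : ℂ) ^ (-((σ : ℂ) + t * I))‖ :=
    P.summable_norm_genInt_cpow (s := (σ : ℂ) + t * I) (by simpa using hσ) (by simpa using hsum)
  unfold BeurlingPrimes.zeta
  calc ‖∑' k : ℕ →₀ ℕ, ((P.genInt k : ℝ) : ℂ) ^ (-((σ : ℂ) + t * I))‖
      ≤ ∑' k : ℕ →₀ ℕ, ‖((P.genInt k : ℝ) : ℂ) ^ (-((σ : ℂ) + t * I))‖ := norm_tsum_le_tsum_norm h1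
    _ = ∑' k : ℕ →₀ ℕ, ‖((P.genInt k : ℝ) : ℂ) ^ (-(σ : ℂ))‖ := by
        refine tsum_congr fun k ↦ ?_
        rw [norm_cpow_eq_rpow_re_of_pos (P.genInt_pos k), norm_cpow_eq_rpow_re_of_pos (P.genInt_pos k)]
        simp

/-- `t ↦ ζ_𝒫(σ + it)` is continuous for `σ > 0` with `Σ_j λ_j^{−σ} < ∞` (uniformly convergent series of
continuous functions). [folklore] -/
theorem _root_.Literature.Barriers.RiemannHypothesis.BeurlingPrimes.continuous_zeta_vertical {σ : ℝ}
    (hσ : 0 < σ) (hsum : Summable fun j ↦ P.prime j ^ (-σ)) :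
    Continuous fun t : ℝ ↦ P.zeta ((σ : ℂ) + t * I) := by
  have hS : Summable fun k : ℕ →₀ ℕ ↦ ‖((P.genInt k : ℝ) : ℂ) ^ (-(σ : ℂ))‖ :=
    P.summable_norm_genInt_cpow (s := (σ : ℂ)) (by simpa using hσ) (by simpa using hsum)
  unfold BeurlingPrimes.zeta
  refine continuous_tsum (fun k ↦ ?_) hS (fun k t ↦ ?_)
  · refine continuous_iff_continuousAt.2 fun t ↦ ?_
    exact (continuousAt_const_cpow (ofReal_ne_zero.2 (P.genInt_pos k).ne')).comp
      (f := fun t : ℝ ↦ -((σ : ℂ) + t * I)) (by fun_prop)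
  · rw [norm_cpow_eq_rpow_re_of_pos (P.genInt_pos k), norm_cpow_eq_rpow_re_of_pos (P.genInt_pos k)]
    simp

/-- **Absolute convergence of the Perron integral.** For `y > 0`, `σ > 1` (with `Σ_j λ_j^{−σ} < ∞`) the
integrand `t ↦ y^{1+s} ζ_𝒫(s)/(s(s+1))`, `s = σ + it`, is integrable on `ℝ` (it is `≪ y^{1+σ} ζ_𝒫(σ)/(σ² + t²)`).
[cite: BrouckeVindas2024, proof of Theorem 3.1] -/
theorem _root_.Literature.Barriers.RiemannHypothesis.BeurlingPrimes.integrable_perronIntegrand {y : ℝ}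
    (hy : 0 < y) {σ : ℝ} (hσ : 0 < σ) (hsum : Summable fun j ↦ P.prime j ^ (-σ)) :
    Integrable fun t : ℝ ↦ (y : ℂ) ^ (1 + ((σ : ℂ) + t * I)) * P.zeta ((σ : ℂ) + t * I) *
      (1 / (((σ : ℂ) + t * I) * ((σ : ℂ) + t * I + 1))) := by
  have hy0 : (y : ℂ) ≠ 0 := ofReal_ne_zero.2 hy.ne'
  set A : ℝ := ∑' k : ℕ →₀ ℕ, ‖((P.genInt k : ℝ) : ℂ) ^ (-(σ : ℂ))‖ with hA
  refine (integrable_kernel hσ).bdd_mul (c := y ^ (1 + σ) * A) ?_ (Eventually.of_forall fun t ↦ ?_)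
  · refine Continuous.aestronglyMeasurable (Continuous.mul ?_ (P.continuous_zeta_vertical hσ hsum))
    refine continuous_iff_continuousAt.2 fun t ↦ ?_
    exact (continuousAt_const_cpow hy0).comp (f := fun t : ℝ ↦ 1 + ((σ : ℂ) + t * I)) (by fun_prop)
  · rw [norm_mul, norm_cpow_eq_rpow_re_of_pos hy]
    have hre : (1 + ((σ : ℂ) + t * I)).re = 1 + σ := by simp
    rw [hre]
    exact mul_le_mul_of_nonneg_left (P.norm_zeta_le_tsum hσ hsum t) (by positivity)

/-- **Perron's formula of order one for Beurling integers** (BV 2024, proof of Thm. 3.1: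
"`N₁(x) = (1/2πi)∫_{κ−i∞}^{κ+i∞} x^{s+1} ζ_𝒫(s)/(s(s+1)) ds`"; BDR 2023, (3.5)). For `y > 0` and `σ > 1` with
`Σ_j λ_j^{−σ} < ∞`:
`Σ_{n ∈ 𝒩} (y − n)⁺ = (1/2π) ∫_{−∞}^{∞} y^{1+s} ζ_𝒫(s)/(s(s+1)) dt`, `s = σ + it`, the integral converging
absolutely (`integrable_perronIntegrand`). [cite: BrouckeVindas2024, proof of Theorem 3.1] -/
theorem _root_.Literature.Barriers.RiemannHypothesis.BeurlingPrimes.rieszCount_eq_integral {y : ℝ} (hy : 0 < y)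
    {σ : ℝ} (hσ : 1 < σ) (hsum : Summable fun j ↦ P.prime j ^ (-σ)) :
    ((P.rieszCount y : ℝ) : ℂ) =
      (1 / (2 * π) : ℂ) * ∫ t : ℝ, (y : ℂ) ^ (1 + ((σ : ℂ) + t * I)) * P.zeta ((σ : ℂ) + t * I) *
        (1 / (((σ : ℂ) + t * I) * ((σ : ℂ) + t * I + 1))) := by
  haveI : Countable (ℕ →₀ ℕ) := encode_injective.countable
  have hσ0 : 0 < σ := by linarith
  have hy0 : (y : ℂ) ≠ 0 := ofReal_ne_zero.2 hy.ne'
  -- the kernel K, the coefficients G k, the terms F k = G k · K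
  set K : ℝ → ℂ := fun t ↦ 1 / (((σ : ℂ) + t * I) * ((σ : ℂ) + t * I + 1)) with hK
  set G : (ℕ →₀ ℕ) → ℝ → ℂ := fun k t ↦ (y : ℂ) ^ (1 + ((σ : ℂ) + t * I)) *
    ((P.genInt k : ℝ) : ℂ) ^ (-((σ : ℂ) + t * I)) with hG
  set F : (ℕ →₀ ℕ) → ℝ → ℂ := fun k t ↦ G k t * K t with hF
  have hnormG : ∀ k t, ‖G k t‖ = y ^ (1 + σ) * ‖((P.genInt k : ℝ) : ℂ) ^ (-(σ : ℂ))‖ := by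
    intro k t
    simp only [hG, norm_mul]
    congr 1
    · rw [norm_cpow_eq_rpow_re_of_pos hy]; simp
    · rw [norm_cpow_eq_rpow_re_of_pos (P.genInt_pos k), norm_cpow_eq_rpow_re_of_pos (P.genInt_pos k)]
      simp
  have hcontG : ∀ k, Continuous (G k) := by
    intro k
    simp only [hG]
    refine Continuous.mul ?_ ?_
    · refine continuous_iff_continuousAt.2 fun t ↦ ?_
      exact (continuousAt_const_cpow hy0).comp (f := fun t : ℝ ↦ 1 + ((σ : ℂ) + t * I)) (by fun_prop)
    · refine continuous_iff_continuousAt.2 fun t ↦ ?_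
      exact (continuousAt_const_cpow (ofReal_ne_zero.2 (P.genInt_pos k).ne')).comp
        (f := fun t : ℝ ↦ -((σ : ℂ) + t * I)) (by fun_prop)
  have hintK : Integrable K := integrable_kernel hσ0
  have hintF : ∀ k, Integrable (F k) := fun k ↦
    hintK.bdd_mul (hcontG k).aestronglyMeasurable (Eventually.of_forall fun t ↦ (hnormG k t).le)
  -- summability of the norms
  have hsumF : Summable fun k ↦ ∫ t, ‖F k t‖ := by
    have hS : Summable fun k : ℕ →₀ ℕ ↦ ‖((P.genInt k : ℝ) : ℂ) ^ (-(σ : ℂ))‖ :=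
      P.summable_norm_genInt_cpow (s := (σ : ℂ)) (by simpa using hσ0) (by simpa using hsum)
    have := (hS.mul_left (y ^ (1 + σ))).mul_right (∫ t : ℝ, ‖K t‖)
    refine this.congr fun k ↦ ?_
    rw [← integral_const_mul]
    refine integral_congr_ae (Eventually.of_forall fun t ↦ ?_)
    simp only [hF, norm_mul, hnormG k t]
  -- left side: sum of the terms
  have hterm : ∀ k : ℕ →₀ ℕ, ((max (y - P.genInt k) 0 : ℝ) : ℂ) = (1 / (2 * π) : ℂ) * ∫ t, F k t :=
    fun k ↦ posPart_sub_eq_integral hy (P.genInt_pos k) hσ0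
  have hlhs : ((P.rieszCount y : ℝ) : ℂ) = ∑' k : ℕ →₀ ℕ, ((max (y - P.genInt k) 0 : ℝ) : ℂ) := by
    rw [BeurlingPrimes.rieszCount, ofReal_tsum]
  rw [hlhs, tsum_congr hterm, tsum_mul_left, integral_tsum_of_summable_integral_norm hintF hsumF]
  congr 1
  refine integral_congr_ae (Eventually.of_forall fun t ↦ ?_)
  simp only [hF, hG, hK]
  rw [BeurlingPrimes.zeta, ← tsum_mul_left, ← tsum_mul_right]

/-- **The differenced Perron integral** (BDR 2023, (3.5)–(3.6); BV 2024): for `0 < y₁ ≤ y₂` and `σ > 1`,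
`N₁(y₂) − N₁(y₁) = (1/2π) ∫ (y₂^{1+s} − y₁^{1+s}) ζ_𝒫(s)/(s(s+1)) dt`; with `(y₁, y₂) = (x, x+1)` the left side
is `∫_x^{x+1} N_𝒫 ≥ N_𝒫(x)` and with `(x−1, x)` it is `≤ N_𝒫(x)`. [cite: BrouckeDebruyneRevesz2023, (3.5)–(3.6)] -/
theorem _root_.Literature.Barriers.RiemannHypothesis.BeurlingPrimes.rieszCount_sub_eq_integral {y₁ y₂ : ℝ}
    (hy₁ : 0 < y₁) (hy₂ : 0 < y₂) {σ : ℝ} (hσ : 1 < σ) (hsum : Summable fun j ↦ P.prime j ^ (-σ)) :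
    ((P.rieszCount y₂ - P.rieszCount y₁ : ℝ) : ℂ) =
      (1 / (2 * π) : ℂ) * ∫ t : ℝ, ((y₂ : ℂ) ^ (1 + ((σ : ℂ) + t * I)) - (y₁ : ℂ) ^ (1 + ((σ : ℂ) + t * I))) *
        P.zeta ((σ : ℂ) + t * I) * (1 / (((σ : ℂ) + t * I) * ((σ : ℂ) + t * I + 1))) := by
  have hσ0 : 0 < σ := by linarith
  have h₁ := P.rieszCount_eq_integral hy₁ hσ hsum
  have h₂ := P.rieszCount_eq_integral hy₂ hσ hsum
  have hi₁ := P.integrable_perronIntegrand hy₁ hσ0 hsum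
  have hi₂ := P.integrable_perronIntegrand hy₂ hσ0 hsum
  rw [ofReal_sub, h₁, h₂, ← mul_sub, ← integral_sub hi₂ hi₁]
  congr 1
  refine integral_congr_ae (Eventually.of_forall fun t ↦ ?_)
  simp only
  ring

end Literature.NumberTheory.BeurlingPrimes
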